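import Summits.QuantumFields.BalabanUV.Beta.GAN24.SymCorrectorZeroMode

/-!
# `BalabanUV.Beta.GAN24.SlotTransportPeriodicWeight` — binder row G-an2-4 ∕ (CONV-C), TRANSFER-III, the (III′) (C)-campaign's supplier `hB0`, toward (24)∕(27) AT THE COMB DATA:
# **A PERIODICALLY WEIGHTED SLOT SUM IS BLIND TO THE SLOT TRANSPORT `Ψ_Sᵀ`** — for every `n`-periodic slot weight `ω` and every bond family `T` with summable components,
# `Σ'_x ω α x · slotPsiS r n T α x = Σ'_x ω α x · T α x` (leaf-01 g84's `tsum_slotPsiS` is `ω ≡ 1`): every block's face sum is weighted by the SAME box total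
# `Σ_{b ∈ box} ω α b · faceWt α b`, and the face sums of a summable family total zero (`tsum_faceSum_eq_zero`)
# (G-an2-4 CRUX TEAM (2), leaf prover `b2b-balaban-gan24-formalise-leaf-01`, gen 85; journal [LEAF01-G85-INTENT-7])

WHY (context only; README-g85 «LOCATED», item (24)_comb).  In leaf-04's 24 ∕ 27 one slot of the two-face word is resummed over its lattice bond `u′`:
`Σ'_{u′} vertexOfK X̃ Lc S ν u′ = Σ_κ Σ'_u (Σ'_{u′} colH X̃ Lc ν u′ κ u) · S κ u`, and the bm kernel's coarse column sums are the EXIT-FACE indicator `𝟙f(u_κ)·[κ = ν]·c`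
(`DressedStepFaceCharges.hasSum_dressedStep_col`) — an `Lc`-PERIODIC slot weight.  At the comb data the table is `𝒯 S = Ψ̂ᵀ ∘ slotPsiS S ∘ Ψ̂`; this file says the slot part of
the transport drops out of every periodically weighted slot sum, so the resummed transported half-vertex is the leg-conjugate `Ψ̂ᵀ ∘ (Σ'_{u′} vertexOfK X̃ Lc S ν u′) ∘ Ψ̂` of the
untransported one — where, for the Wilson table, `Ψ̂` meets the block-periodic exit-face current and the periodic face weight (both fixed by `Ψ_S`, leaf-01 g84's F5), reducing
(24)_comb to (E)'s fact (d1).  Nothing of that reduction beyond §1–§2 is typed here.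

NOT IN PRINT; OUR BOOKKEEPING ([folklore] lattice-sum bookkeeping BY NAME over leaf-01 g84's `SymCorrectorZeroMode` (`summable_faceSum`, `tsum_faceSum_eq_zero`, `summable_comp_blk`,
`faceWt_block`, `slotPsiS_eq_add_mul_sum_sigma`) and leaf-02's `BiStencilZeroMode.tsum_eq_sum_box_tsum`; 0 `def`, 0 cited fact, 0 `def … : Prop`, 0 sorry).
HONEST FRAMING (cell contract, verbatim): «discharging `BetaPertH` makes Bałaban's UV stability UNCONDITIONAL — a real constructive-QFT result; it is NOT the continuum limit and NOT
the Clay problem.»  HONEST DEPENDENCY (verbatim): «continuum YM on T⁴ ⇐ BetaPertH ∧ nine spine estimates (0/9 proved); BetaPertH ⇐ (D1) ∧ (D4) ∧ CAP+tail; G-an2-4 gates asym, D1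
and NE2/3/4.»

## What is proved (generic `d`, `0 < n`, any root offset `r`)
* §1 `summable_weight_mul`, `summable_weight_mul_faceWt_mul_faceSum`, **`tsum_weight_mul_faceWt_mul_comp_blk`** (`Σ'_x ω α x·faceWt α x·g (blk x) = (Σ_{b∈box} ω α b·faceWt α b)·Σ'_Y g Y` for an
  `n`-periodic `ω`), **`tsum_weight_mul_slotPsiS`** (`Σ'_x ω α x · slotPsiS r n T α x = Σ'_x ω α x · T α x`).
* §2 the kernel-valued form: **`tsum_weight_mul_slotPsiS_kernel`** — for a stencil family `S` with summable entries, every entry `(p, q, a, b)`: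
  `Σ'_x ω α x · slotPsiS r n S α x p q a b = Σ'_x ω α x · S α x p q a b`.
WHAT THIS IS NOT: (24)_comb ∕ (27)_comb are NOT proved here; NO value; NOT `hB0`; the (III′) campaign is NOT asked (an2 W-4); NEVER «G-an2-4 closed» as (CONV-C); NOT D1, NOT `BetaPertH`,
NOT continuum, NOT Clay.  2026-08-27; no existing file touched.
-/

noncomputable section

open Finset
open scoped BigOperators
open Literature.MathematicalPhysics.QuantumFieldTheory
open Literature.MathematicalPhysics.QuantumFieldTheory.Balaban1983to89
open Literature.MathematicalPhysics.QuantumFieldTheory.Balaban1983to89.Beta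
open ExpKernelCalculus (Site MKer)
open OneStepResolventKernel (Fib)
open AffineAveraging (Form1 box toSite)
open AveragingContours (blk blk_block)
open Summit.QuantumFields.BalabanUV.Beta.SymCorrectorFace (faceWt faceWtSum abs_faceWt_le faceSum slotPsiS slotPsiS_apply_kernel)
open Summit.QuantumFields.BalabanUV.Beta.GAN24.SymCorrectorZeroMode (summable_faceSum tsum_faceSum_eq_zero summable_comp_blk faceWt_block)

namespace Summit.QuantumFields.BalabanUV.Beta.GAN24.SlotTransportPeriodicWeight

variable {d : ℕ} {n : ℕ} (hn : 0 < n)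
include hn

/-! ## §1 Periodically weighted slot sums -/

omit hn in
/-- [folklore] A bounded weight times a summable family is summable. -/
theorem summable_weight_mul {ω g : Site (d + 1) → ℝ} {B : ℝ} (hω : ∀ x, |ω x| ≤ B) (hg : Summable g) : Summable fun x => ω x * g x := by
  refine Summable.of_norm_bounded (hg.abs.mul_left B) fun x => ?_
  rw [Real.norm_eq_abs, abs_mul]
  exact mul_le_mul_of_nonneg_right (hω x) (abs_nonneg _)

/-- [folklore] The weighted face family `x ↦ ω x · faceWt α x · faceSum n T (blk x)` of a summable family is summable. -/
theorem summable_weight_mul_faceWt_mul_faceSum (r : Fin (d + 1) → ℕ) {T : Form1 (d + 1) ℝ} (hT : ∀ κ, Summable (T κ)) {ω : Site (d + 1) → ℝ} {B : ℝ}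
    (hω : ∀ x, |ω x| ≤ B) (α : Fin (d + 1)) :
    Summable fun x : Site (d + 1) => ω x * faceWt r n α x * faceSum n T (blk n x) := by
  have h := summable_weight_mul (B := B * faceWtSum r n) (ω := fun x => ω x * faceWt r n α x) (fun x => by
    rw [abs_mul]; exact mul_le_mul (hω x) (abs_faceWt_le hn r α x) (abs_nonneg _) ((abs_nonneg _).trans (hω x))) (summable_comp_blk hn (summable_faceSum hn hT))
  simpa [mul_assoc] using h

/-- [folklore] **A PERIODICALLY FACE-WEIGHTED SUM OF A BLOCK FUNCTION FACTORISES**: for an `n`-periodic weight `ω`,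
`Σ'_x ω x · faceWt α x · g (blk x) = (Σ_{b ∈ box} ω b · faceWt α b) · Σ'_Y g Y` whenever the left series converges. -/
theorem tsum_weight_mul_faceWt_mul_comp_blk (r : Fin (d + 1) → ℕ) (α : Fin (d + 1)) {g ω : Site (d + 1) → ℝ} (hωper : ∀ x t : Site (d + 1), ω (x + (n : ℤ) • t) = ω x)
    (hfg : Summable fun x : Site (d + 1) => ω x * faceWt r n α x * g (blk n x)) :
    ∑' x, ω x * faceWt r n α x * g (blk n x) = (∑ b ∈ box (d + 1) n, ω (toSite b) * faceWt r n α (toSite b)) * ∑' Y, g Y := by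
  haveI : NeZero n := ⟨hn.ne'⟩
  rw [BiStencilZeroMode.tsum_eq_sum_box_tsum (N := n) hfg, Finset.sum_mul]
  refine Finset.sum_congr rfl fun b hb => ?_
  have hωb : ∀ t : Site (d + 1), ω ((n : ℤ) • t + toSite b) = ω (toSite b) := fun t => by rw [add_comm, hωper]
  simp only [faceWt_block hn, blk_block _ hb, hωb]
  rw [← tsum_mul_left]

/-- NOT IN PRINT; OUR BOOKKEEPING ([folklore]).  **A PERIODICALLY WEIGHTED SLOT SUM IS BLIND TO THE SLOT TRANSPORT**: for a bond family `T` with summable components and an `n`-periodic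
bounded weight `ω`, `Σ'_x ω x · slotPsiS r n T α x = Σ'_x ω x · T α x` — the weighted face family totals `(Σ_{b∈box} ω b·faceWt α b) · Σ'_Y faceSum n T Y = 0`. -/
theorem tsum_weight_mul_slotPsiS (r : Fin (d + 1) → ℕ) {T : Form1 (d + 1) ℝ} (hT : ∀ κ, Summable (T κ)) {ω : Site (d + 1) → ℝ} {B : ℝ} (hω : ∀ x, |ω x| ≤ B)
    (hωper : ∀ x t : Site (d + 1), ω (x + (n : ℤ) • t) = ω x) (α : Fin (d + 1)) :
    ∑' x, ω x * slotPsiS r n T α x = ∑' x, ω x * T α x := by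
  have e : ∀ x, ω x * slotPsiS r n T α x = ω x * T α x + ω x * faceWt r n α x * faceSum n T (blk n x) := fun x => by
    show ω x * (T α x + faceWt r n α x * faceSum n T (blk n x)) = _
    ring
  have hs := summable_weight_mul_faceWt_mul_faceSum hn r hT hω α
  rw [tsum_congr e, (summable_weight_mul hω (hT α)).tsum_add hs, tsum_weight_mul_faceWt_mul_comp_blk hn r α hωper hs, tsum_faceSum_eq_zero hn hT, mul_zero, add_zero]

/-! ## §2 The kernel-valued form -/

/-- NOT IN PRINT; OUR BOOKKEEPING ([folklore]).  **ENTRYWISE, FOR STENCIL FAMILIES**: if every entry family `x ↦ S κ x p q a b` is summable, then for every `n`-periodic bounded weight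
`Σ'_x ω x · slotPsiS r n S α x p q a b = Σ'_x ω x · S α x p q a b` (`slotPsiS_apply_kernel` ⨾ §1). -/
theorem tsum_weight_mul_slotPsiS_kernel (r : Fin (d + 1) → ℕ) {S : Fin (d + 1) → Site (d + 1) → MKer (d + 1) (Fib d)} (p q : Site (d + 1)) (a b : Fib d)
    (hS : ∀ κ, Summable fun x => S κ x p q a b) {ω : Site (d + 1) → ℝ} {B : ℝ} (hω : ∀ x, |ω x| ≤ B) (hωper : ∀ x t : Site (d + 1), ω (x + (n : ℤ) • t) = ω x)
    (α : Fin (d + 1)) :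
    ∑' x, ω x * slotPsiS r n S α x p q a b = ∑' x, ω x * S α x p q a b := by
  have e : ∀ x, slotPsiS r n S α x p q a b = slotPsiS r n (fun κ u => S κ u p q a b) α x := fun x => slotPsiS_apply_kernel r n S α x p q a b
  simp only [e]
  exact tsum_weight_mul_slotPsiS hn r (T := fun κ u => S κ u p q a b) hS hω hωper α

end Summit.QuantumFields.BalabanUV.Beta.GAN24.SlotTransportPeriodicWeight

end
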